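import Summits.Ventures.CertifiedArithmetic.LowPrec.SRCountingChain
import HarnessLib

/-!
# Stochastic rounding into a finite format, XXV: all-`n` counting-chain laws for the FP6 formats

HONEST FRAMING: certified error envelopes and provably optimal rounding/accumulation schemes for
low-precision formats under stated cost models; every table by two implementations; no hardware or
vendor claims.

Venture CertifiedArithmetic / lowprec, SR slice (gen5).  Completes file XXIV for the two OCP FP6
formats, for EVERY number of summands:

* **E3M2, all-`n` box form** (`CountE3M2.e3m2_box_all_n`): every recursive E3M2 SR sum of
  `k + 8` rationals in `[0, 1]` saturates with probability at most `h_k(8)` (the explicit 7-state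
  chain of file XXIV), and of `k + 8` rationals `≥ 1` with probability at least `h_k(8)` — sharp at
  the all-ones corner; e.g. `h_8 = 2^{-10}`, `h_{24} = 3260157053385/2^42`.
* **E2M3 is deterministic** (`CountE2M3.e2m3_ones_satProb`, `e2m3_ones_noSat`, `e2m3_box_all_n`):
  every integer `1, …, 7` is an E2M3 value and `8 > 15/2 = maxRat`, so the recursive SR sum of
  `n` ones saturates with probability exactly `[n ≥ 8]`; hence every recursive E2M3 SR sum of at
  least `8` rationals each `≥ 1` saturates SURELY (probability `1`), and of at most `7` rationals in
  `[0, 1]` never does (probability `0`) — for all such data, no enumeration.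
-/

namespace Summit.Ventures.CertifiedArithmetic.LowPrec.SR

open Literature.ComputerArithmetic.ConnollyHighamMary2021 Finset STree

/-! ### E3M2: the all-`n` box form -/

namespace CountE3M2

/-- **Box form, every `n ≥ 8` (E3M2).** Data in `[0, 1]`: `P(sat) ≤ h_k(8)`; data `≥ 1`:
`P(sat) ≥ h_k(8)` (`k + 8` summands, recursive order). -/
theorem e3m2_box_all_n (k : ℕ) (x : ℕ → ℚ) (s : ℚ) :
    ((0 ≤ s ∧ s ≤ 1) → (∀ i, 0 ≤ x i ∧ x i ≤ 1) →
      satProbT Formats.e3m2 (comb x s (k + 7)) ≤ h k 8) ∧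
    (1 ≤ s → (∀ i, 1 ≤ x i) → h k 8 ≤ satProbT Formats.e3m2 (comb x s (k + 7))) := by
  obtain ⟨hlo, hhi, h0, hb⟩ := LawE3M2.e3m2_hull
  have hx : exitE Formats.e3m2 upE (comb (fun _ => (1 : ℚ)) 1 (k + 7)) = h k 8 := by
    rw [exitE_comb_const_eq_hitProb]; exact h_start k
  refine ⟨fun hs hx' => ?_, fun hs hx' => ?_⟩
  · have h₁ : LeafLE ((comb x s (k + 7)).map fun _ => (0 : ℚ)) (comb x s (k + 7)) := by
      rw [map_comb]; exact leafLE_comb hs.1 (fun i => (hx' i).1) _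
    have h₂ : LeafLE (comb x s (k + 7)) (comb (fun _ => (1 : ℚ)) 1 (k + 7)) :=
      leafLE_comb hs.2 (fun i => (hx' i).2) _
    have h := satProbT_le_upper_corner hlo hhi hb h0 (by norm_num) h₁ h₂
    rwa [show (fun c => decide ((28 : ℚ) < c)) = upE from rfl, hx] at h
  · have h := corner_le_satProbT hlo hhi hb (x := fun _ => (1 : ℚ)) (s := 1) hs hx'
      (le_refl (k + 7))
    rwa [show (fun c => decide ((28 : ℚ) < c)) = upE from rfl, hx] at h

end CountE3M2

/-! ### E2M3: deterministic saturation -/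

namespace CountE2M3

/-- Hull data of E2M3: extremes `∓15/2`, zero, bounds. -/
theorem e2m3_hull : (-15 / 2 : ℚ) ∈ Formats.e2m3 ∧ (15 / 2 : ℚ) ∈ Formats.e2m3 ∧
    (0 : ℚ) ∈ Formats.e2m3 ∧ ∀ y ∈ Formats.e2m3, (-15 / 2 : ℚ) ≤ y ∧ y ≤ 15 / 2 := by
  decide +kernel

/-- The upper-exit predicate of E2M3 (`maxRat = 15/2`). -/
def upE : ℚ → Bool := fun c => decide ((15 / 2 : ℚ) < c)

/-- The hitting recursion of the ones chain in E2M3, abbreviated. -/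
def h (k : ℕ) (a : ℚ) : ℚ := hitProb Formats.e2m3 upE 1 k a

/-- Deterministic step: `h_{k+1}(a) = h_k(a + 1)` when `a + 1` is a format value. -/
theorem h_det {a : ℚ} (ha : a + 1 ∈ Formats.e2m3) (he : upE (a + 1) = false) (k : ℕ) :
    h (k + 1) a = h k (a + 1) := by
  show hitProb Formats.e2m3 upE 1 (k + 1) a = _
  simp only [hitProb, he]
  exact step_of_mem ha _

/-- From `7` the next increment exits surely (`8 > 15/2`). -/
theorem h_seven (k : ℕ) : h (k + 1) 7 = 1 := by
  have he : upE (7 + 1) = true := by decide +kernel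
  show hitProb Formats.e2m3 upE 1 (k + 1) 7 = _
  simp only [hitProb, he]; rfl

/-- Six deterministic steps `1, 2, …, 7`. -/
theorem h_start (k : ℕ) : h (k + 6) 1 = h k 7 := by
  have d : ∀ a : ℚ, a + 1 ∈ Formats.e2m3 → upE (a + 1) = false → ∀ j, h (j + 1) a = h j (a + 1) :=
    fun a ha he j => h_det ha he j
  rw [show k + 6 = (k + 5) + 1 by omega, d 1 (by decide +kernel) (by decide +kernel),
    show (1 : ℚ) + 1 = 2 by norm_num,
    show k + 5 = (k + 4) + 1 by omega, d 2 (by decide +kernel) (by decide +kernel),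
    show (2 : ℚ) + 1 = 3 by norm_num,
    show k + 4 = (k + 3) + 1 by omega, d 3 (by decide +kernel) (by decide +kernel),
    show (3 : ℚ) + 1 = 4 by norm_num,
    show k + 3 = (k + 2) + 1 by omega, d 4 (by decide +kernel) (by decide +kernel),
    show (4 : ℚ) + 1 = 5 by norm_num,
    show k + 2 = (k + 1) + 1 by omega, d 5 (by decide +kernel) (by decide +kernel),
    show (5 : ℚ) + 1 = 6 by norm_num, d 6 (by decide +kernel) (by decide +kernel),
    show (6 : ℚ) + 1 = 7 by norm_num]

/-- Upper-exit probability of the ones chain: `1` from `8` summands on, `0` up to `7`. -/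
theorem exitUp_ones (m : ℕ) :
    exitE Formats.e2m3 upE (comb (fun _ => (1 : ℚ)) 1 m) = if 7 ≤ m then 1 else 0 := by
  rw [exitE_comb_const_eq_hitProb]
  show h m 1 = _
  split_ifs with hm
  · obtain ⟨k, rfl⟩ := Nat.exists_eq_add_of_le' hm
    rw [show k + 7 = (k + 1) + 6 by omega, h_start, h_seven]
  · -- `m ≤ 6`: the chain is still in the exact region, `h_m(1) = h_0(1 + m) = 0`
    have key : ∀ j ≤ 6, h j 1 = 0 := by
      have z : ∀ a : ℚ, h 0 a = 0 := fun _ => rfl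
      have d : ∀ a : ℚ, a + 1 ∈ Formats.e2m3 → upE (a + 1) = false → ∀ j, h (j + 1) a = h j (a + 1) :=
        fun a ha he j => h_det ha he j
      intro j hj
      interval_cases j
      · exact z 1
      · rw [d 1 (by decide +kernel) (by decide +kernel), z]
      · rw [d 1 (by decide +kernel) (by decide +kernel), show (1 : ℚ) + 1 = 2 by norm_num,
          d 2 (by decide +kernel) (by decide +kernel), z]
      · rw [d 1 (by decide +kernel) (by decide +kernel), show (1 : ℚ) + 1 = 2 by norm_num,
          d 2 (by decide +kernel) (by decide +kernel), show (2 : ℚ) + 1 = 3 by norm_num,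
          d 3 (by decide +kernel) (by decide +kernel), z]
      · rw [d 1 (by decide +kernel) (by decide +kernel), show (1 : ℚ) + 1 = 2 by norm_num,
          d 2 (by decide +kernel) (by decide +kernel), show (2 : ℚ) + 1 = 3 by norm_num,
          d 3 (by decide +kernel) (by decide +kernel), show (3 : ℚ) + 1 = 4 by norm_num,
          d 4 (by decide +kernel) (by decide +kernel), z]
      · rw [d 1 (by decide +kernel) (by decide +kernel), show (1 : ℚ) + 1 = 2 by norm_num,
          d 2 (by decide +kernel) (by decide +kernel), show (2 : ℚ) + 1 = 3 by norm_num,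
          d 3 (by decide +kernel) (by decide +kernel), show (3 : ℚ) + 1 = 4 by norm_num,
          d 4 (by decide +kernel) (by decide +kernel), show (4 : ℚ) + 1 = 5 by norm_num,
          d 5 (by decide +kernel) (by decide +kernel), z]
      · rw [d 1 (by decide +kernel) (by decide +kernel), show (1 : ℚ) + 1 = 2 by norm_num,
          d 2 (by decide +kernel) (by decide +kernel), show (2 : ℚ) + 1 = 3 by norm_num,
          d 3 (by decide +kernel) (by decide +kernel), show (3 : ℚ) + 1 = 4 by norm_num,
          d 4 (by decide +kernel) (by decide +kernel), show (4 : ℚ) + 1 = 5 by norm_num,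
          d 5 (by decide +kernel) (by decide +kernel), show (5 : ℚ) + 1 = 6 by norm_num,
          d 6 (by decide +kernel) (by decide +kernel), z]
    exact key m (by omega)

/-- **All-`n` law (E2M3, counting by ones): deterministic.**  The recursive SR sum of `m + 1` ones
saturates with probability exactly `[m + 1 ≥ 8]`. -/
theorem e2m3_ones_satProb (m : ℕ) :
    satProbT Formats.e2m3 (comb (fun _ => (1 : ℚ)) 1 m) = if 7 ≤ m then 1 else 0 := by
  obtain ⟨hlo, hhi, h0, hb⟩ := e2m3_hull
  refine le_antisymm ?_ ?_
  · have h₁ : LeafLE ((comb (fun _ => (1 : ℚ)) 1 m).map fun _ => (0 : ℚ))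
        (comb (fun _ => (1 : ℚ)) 1 m) := by
      rw [map_comb]; exact leafLE_comb (by norm_num) (fun _ => by norm_num) _
    have h := satProbT_le_upper_corner hlo hhi hb h0 (by norm_num) h₁ (LeafLE.refl _)
    rwa [show (fun c => decide ((15 / 2 : ℚ) < c)) = upE from rfl, exitUp_ones] at h
  · have h := exitE_upper_le_satProbT hlo hhi hb (comb (fun _ => (1 : ℚ)) 1 m)
    rwa [show (fun c => decide ((15 / 2 : ℚ) < c)) = upE from rfl, exitUp_ones] at h

/-- **Sure saturation / sure no-saturation for all data (E2M3).**  Every recursive E2M3 SR sum of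
at least `8` rationals each `≥ 1` saturates with probability `1`; every recursive E2M3 SR sum of
at most `7` rationals in `[0, 1]` saturates with probability `0`. -/
theorem e2m3_box_all_n (m : ℕ) (x : ℕ → ℚ) (s : ℚ) :
    (7 ≤ m → 1 ≤ s → (∀ i, 1 ≤ x i) → satProbT Formats.e2m3 (comb x s m) = 1) ∧
    (m ≤ 6 → (0 ≤ s ∧ s ≤ 1) → (∀ i, 0 ≤ x i ∧ x i ≤ 1) →
      satProbT Formats.e2m3 (comb x s m) = 0) := by
  obtain ⟨hlo, hhi, h0, hb⟩ := e2m3_hull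
  refine ⟨fun hm hs hx => le_antisymm ?_ ?_, fun hm hs hx => le_antisymm ?_ ?_⟩
  · exact exitProb_le_one _ _ _
  · have h := corner_le_satProbT hlo hhi hb (x := fun _ => (1 : ℚ)) (s := 1) hs hx (le_refl m)
    rwa [show (fun c => decide ((15 / 2 : ℚ) < c)) = upE from rfl, exitUp_ones, if_pos hm] at h
  · have h₁ : LeafLE ((comb x s m).map fun _ => (0 : ℚ)) (comb x s m) := by
      rw [map_comb]; exact leafLE_comb hs.1 (fun i => (hx i).1) _
    have h₂ : LeafLE (comb x s m) (comb (fun _ => (1 : ℚ)) 1 m) :=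
      leafLE_comb hs.2 (fun i => (hx i).2) _
    have h := satProbT_le_upper_corner hlo hhi hb h0 (by norm_num) h₁ h₂
    rwa [show (fun c => decide ((15 / 2 : ℚ) < c)) = upE from rfl, exitUp_ones,
      if_neg (by omega)] at h
  · exact exitProb_nonneg _ _ _

end CountE2M3

end Summit.Ventures.CertifiedArithmetic.LowPrec.SR
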